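import Mathlib
import Literature.Barriers.ValiantsHypothesis.AlgebraicNaturalProofs
import Literature.Computability.AlgebraicComplexity.ArithCircuitProofs
import Literature.Computability.AlgebraicComplexity.IMMInVPProofs
import Summits.ValiantsHypothesis.ValiantsHypothesis.Theorems.BarrierLeverPartitionMinorsHitByVPSplitDoor
import Summits.ValiantsHypothesis.ValiantsHypothesis.Theorems.BarrierLeverPartitionMinorsHitByVPStrataDoorPrelims

/-!
# Route BarrierLever — item `PartitionMinorsHitByVP` (stmt-ValiantsHypothesis-19717):
# the POTENTIAL door — the LP-duality form of the rescaling method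

Helper file (`--supports stmt-ValiantsHypothesis-19717`; cell valiant-natproofs, rung V4, 𝒟-side,
prover seat val-np-p6 gen 2). Definition-free. Closes NO item.

The m-strata door `…StrataDoor.partitionMinor_hit_of_strata` (p448281, seat val-np-p6 gen 0) glues
per-stratum witnesses `F t` along the strata of ONE threshold pair `(λ, μ)`: the summand `t` is
rescaled by `x_a ↦ x₀^{2tλ_a} x_a`, `y_c ↦ x₀^{2π(t)μ_c} y_c`, and a convex ENVELOPE argument shows
that the `x₀`-degree of the `(i,j)` entry is dominated by row/column potentials with equality exactly
on the diagonal blocks. This file states the gluing step in its final form.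

* **`partitionMinor_hit_of_potentials`** (THE POTENTIAL DOOR = LP duality). Summand `t < m` is
  rescaled by ARBITRARY integer weights `x_a ↦ x₀^{λ_{t,a}} x_a`, `y_c ↦ x₀^{μ_{t,c}} y_c` and
  shifted by `x₀^{k_t + k'_t}`, so its `(i,j)` entry has `x₀`-exponent
  `ρ_t(i) + κ_t(j)`, `ρ_t(i) = k_t + Σ_{a ∈ u_i} λ_{t,a}`, `κ_t(j) = k'_t + Σ_{c ∈ w_j} μ_{t,c}`.
  If user-supplied potentials `Φ, Ψ` dominate, `ρ_t(i) + κ_t(j) ≤ Φ(i) + Ψ(j)` for all `t, i, j`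
  (a dual-feasible solution of the assignment LP), then the coefficient of `x₀^{ΣΦ+ΣΨ}` in `det` is
  the determinant of the TIGHT matrix `N(i,j) = Σ_{t : ρ_t(i)+κ_t(j) = Φ(i)+Ψ(j)} M_{F t}(i,j)`
  (`…StrataDoor.coeff_det_eq_det_coeff`); so `det N ≠ 0` gives a witness of size
  `≤ Σ_t L(F t) + m(2h+2)` and degree `≤ max_t deg(F t)`. Every door of the rescaling family
  (bi-threshold split p442956, m-strata p448281, the cell door of `…CellDoor`, hierarchies of any
  depth) is this theorem plus a combinatorial reason why `det N ≠ 0` (block-diagonal, block-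
  triangular, unique perfect matching of the tight pattern, …).

WHAT THIS IS NOT: which layouts admit poly(h)-summand certificates is OPEN (the content of item
19717 on the random-like middle band `r ≈ 2^{h/2}`, where support-based adaptive witnesses are known
to die, memo ADAPTIVE-WITNESSES-MEMO-g6 §1); nothing here bears on TT / item 19616 / 19761, on
crux 14610 or on VP vs VNP.
-/

set_option linter.dupNamespace false

namespace Summit.ValiantsHypothesis.ValiantsHypothesis.Theorems.BarrierLever.StrataDoor

open Finset
open Literature.Barriers.ValiantsHypothesis Literature.Computability.AlgebraicComplexity
open Summit.ValiantsHypothesis.ValiantsHypothesis.Theorems.BarrierLever.ThresholdDoor (prod_ite_zpow)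
open Summit.ValiantsHypothesis.ValiantsHypothesis.Theorems.BarrierLever.SplitDoor
  (coeff_rescale totalDegree_rescale_le complexity_rescale_le rescale_factor_partition)

/-! ## 1. The potential door -/

/-- A member of a double sum of absolute values plus a single sum of absolute values is dominated by
it: `0 ≤ (Σ_{t<m} Σ_i |R t i| + Σ_i |P i|) + R t i` for `t < m`. -/
theorem neg_le_of_mem_sum_abs_add {ι : Type*} [Fintype ι] (m : ℕ) (R : ℕ → ι → ℤ) (P : ι → ℤ)
    (t : ℕ) (ht : t < m) (i : ι) :
    0 ≤ (∑ t' ∈ Finset.range m, ∑ i', |R t' i'|) + (∑ i', |P i'|) + R t i := by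
  have h1 : |R t i| ≤ ∑ i', |R t i'| :=
    Finset.single_le_sum (f := fun i' => |R t i'|) (fun _ _ => abs_nonneg _) (Finset.mem_univ i)
  have h2 : (∑ i', |R t i'|) ≤ ∑ t' ∈ Finset.range m, ∑ i', |R t' i'| :=
    Finset.single_le_sum (f := fun t' => ∑ i', |R t' i'|)
      (fun _ _ => Finset.sum_nonneg fun _ _ => abs_nonneg _) (Finset.mem_range.mpr ht)
  have h3 := neg_abs_le (R t i)
  have h4 : 0 ≤ ∑ i', |P i'| := Finset.sum_nonneg fun _ _ => abs_nonneg _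
  linarith

/-- The potential itself is dominated: `0 ≤ (Σ_{t<m} Σ_i |R t i| + Σ_i |P i|) + P i`. -/
theorem neg_le_of_mem_sum_abs_add' {ι : Type*} [Fintype ι] (m : ℕ) (R : ℕ → ι → ℤ) (P : ι → ℤ)
    (i : ι) : 0 ≤ (∑ t' ∈ Finset.range m, ∑ i', |R t' i'|) + (∑ i', |P i'|) + P i := by
  have h1 : |P i| ≤ ∑ i', |P i'| :=
    Finset.single_le_sum (f := fun i' => |P i'|) (fun _ _ => abs_nonneg _) (Finset.mem_univ i)
  have h3 := neg_abs_le (P i)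
  have h4 : 0 ≤ ∑ t' ∈ Finset.range m, ∑ i', |R t' i'| :=
    Finset.sum_nonneg fun _ _ => Finset.sum_nonneg fun _ _ => abs_nonneg _
  linarith

/-- **The potential door (LP duality form of the rescaling method).** Rows and columns indexed by
`ι`; `m` sub-witnesses `F t`; summand `t` carries the row score `ρ t i = kr t + Σ_{a ∈ u i} lam t a`
and the column score `κ t j = kc t + Σ_{c ∈ w j} mu t c` (the `x₀`-exponent of its `(i,j)` entry is
`ρ t i + κ t j`). If potentials `Φ, Ψ : ι → ℤ` satisfy `ρ t i + κ t j ≤ Φ i + Ψ j` for all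
`t < m` and all `i, j`, and the TIGHT matrix
`N i j = Σ_{t < m, ρ t i + κ t j = Φ i + Ψ j} coeff_{x^{u i} y^{w j}} (F t)` is nonsingular, then some
`f` of size `≤ Σ_{t<m} L(F t) + m(2h+2)` and degree `≤ max_t deg(F t)` has a nonsingular layout
matrix on `(u, w)`. -/
theorem partitionMinor_hit_of_potentials {ι : Type*} [Fintype ι] [DecidableEq ι] (h m : ℕ)
    (u w : ι → Finset (Fin h)) (lam mu : ℕ → Fin h → ℤ) (kr kc : ℕ → ℤ) (Φ Ψ : ι → ℤ)
    (hdom : ∀ t < m, ∀ i j : ι,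
      kr t + ∑ a ∈ u i, lam t a + (kc t + ∑ c ∈ w j, mu t c) ≤ Φ i + Ψ j)
    (F : ℕ → MvPolynomial (Fin (h + h)) ℂ)
    (hN : (Matrix.of fun i j : ι => ∑ t ∈ Finset.range m,
        (if kr t + ∑ a ∈ u i, lam t a + (kc t + ∑ c ∈ w j, mu t c) = Φ i + Ψ j then
          MvPolynomial.coeff (∑ a ∈ u i, Finsupp.single (Fin.castAdd h a) 1 +
            ∑ c ∈ w j, Finsupp.single (Fin.natAdd h c) 1) (F t) else 0)).det ≠ 0) :
    ∃ f : MvPolynomial (Fin (h + h)) ℂ,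
      f.totalDegree ≤ (Finset.range m).sup (fun t => (F t).totalDegree) ∧
      complexity f ≤ ∑ t ∈ Finset.range m, complexity (F t) + m * (h + h + 2) ∧
      (Matrix.of fun i j : ι => MvPolynomial.coeff
        (∑ a ∈ u i, Finsupp.single (Fin.castAdd h a) 1 +
          ∑ c ∈ w j, Finsupp.single (Fin.natAdd h c) 1) f).det ≠ 0 := by
  classical
  -- scores
  set R : ℕ → ι → ℤ := fun t i => kr t + ∑ a ∈ u i, lam t a with hR
  set Cx : ℕ → ι → ℤ := fun t j => kc t + ∑ c ∈ w j, mu t c with hCx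
  -- nonnegative shifts
  set G₁ : ℤ := (∑ t ∈ Finset.range m, ∑ i, |R t i|) + ∑ i, |Φ i| with hG₁
  set G₂ : ℤ := (∑ t ∈ Finset.range m, ∑ j, |Cx t j|) + ∑ j, |Ψ j| with hG₂
  have hG₁ge : ∀ t < m, ∀ i, 0 ≤ G₁ + R t i := fun t ht i => neg_le_of_mem_sum_abs_add m R Φ t ht i
  have hG₂ge : ∀ t < m, ∀ j, 0 ≤ G₂ + Cx t j := fun t ht j =>
    neg_le_of_mem_sum_abs_add m Cx Ψ t ht j
  have hG₁Φ : ∀ i, 0 ≤ G₁ + Φ i := fun i => neg_le_of_mem_sum_abs_add' m R Φ i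
  have hG₂Ψ : ∀ j, 0 ≤ G₂ + Ψ j := fun j => neg_le_of_mem_sum_abs_add' m Cx Ψ j
  -- natural exponents and potentials
  set D : ℕ → ι → ι → ℕ := fun t i j => (G₁ + R t i + (G₂ + Cx t j)).toNat with hD
  set Φn : ι → ℕ := fun i => (G₁ + Φ i).toNat with hΦn
  set Ψn : ι → ℕ := fun j => (G₂ + Ψ j).toNat with hΨn
  have hD_cast : ∀ t < m, ∀ i j, ((D t i j : ℕ) : ℤ) = G₁ + R t i + (G₂ + Cx t j) :=
    fun t ht i j => Int.toNat_of_nonneg (by have := hG₁ge t ht i; have := hG₂ge t ht j; linarith)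
  have hΦ_cast : ∀ i, ((Φn i : ℕ) : ℤ) = G₁ + Φ i := fun i => Int.toNat_of_nonneg (hG₁Φ i)
  have hΨ_cast : ∀ j, ((Ψn j : ℕ) : ℤ) = G₂ + Ψ j := fun j => Int.toNat_of_nonneg (hG₂Ψ j)
  have hD_le : ∀ t < m, ∀ i j, D t i j ≤ Φn i + Ψn j := by
    intro t ht i j
    have h1 := hdom t ht i j
    have : ((D t i j : ℕ) : ℤ) ≤ (Φn i : ℤ) + (Ψn j : ℤ) := by
      rw [hD_cast t ht, hΦ_cast, hΨ_cast]
      simp only [hR, hCx] at h1 ⊢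
      linarith
    exact_mod_cast this
  have hD_eq : ∀ t < m, ∀ i j, D t i j = Φn i + Ψn j ↔
      kr t + ∑ a ∈ u i, lam t a + (kc t + ∑ c ∈ w j, mu t c) = Φ i + Ψ j := by
    intro t ht i j
    constructor
    · intro hh
      have := congrArg (Nat.cast : ℕ → ℤ) hh
      push_cast at this
      rw [hD_cast t ht, hΦ_cast, hΨ_cast] at this
      simp only [hR, hCx] at this
      linarith
    · intro hh
      have : ((D t i j : ℕ) : ℤ) = (Φn i : ℤ) + (Ψn j : ℤ) := by
        rw [hD_cast t ht, hΦ_cast, hΨ_cast]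
        simp only [hR, hCx]
        linarith
      exact_mod_cast this
  -- coefficient matrices of the sub-witnesses and the polynomial matrix
  set p : ℕ → Matrix ι ι ℂ := fun t => Matrix.of fun i j => MvPolynomial.coeff
    (∑ a ∈ u i, Finsupp.single (Fin.castAdd h a) 1 + ∑ c ∈ w j, Finsupp.single (Fin.natAdd h c) 1)
    (F t) with hp
  set A : Matrix ι ι (Polynomial ℂ) := Matrix.of fun i j =>
    ∑ t ∈ Finset.range m, Polynomial.C (p t i j) * Polynomial.X ^ D t i j with hA
  have hAdeg : ∀ i j, (A i j).natDegree ≤ Φn i + Ψn j := by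
    intro i j
    simp only [hA, Matrix.of_apply]
    refine Polynomial.natDegree_sum_le_of_forall_le _ _ fun t ht => ?_
    exact (Polynomial.natDegree_C_mul_X_pow_le _ _).trans (hD_le t (Finset.mem_range.mp ht) i j)
  have hAcoeff : ∀ i j, (A i j).coeff (Φn i + Ψn j) = ∑ t ∈ Finset.range m,
      (if kr t + ∑ a ∈ u i, lam t a + (kc t + ∑ c ∈ w j, mu t c) = Φ i + Ψ j then p t i j else 0) := by
    intro i j
    simp only [hA, Matrix.of_apply]
    rw [Polynomial.finsetSum_coeff]
    refine Finset.sum_congr rfl fun t ht => ?_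
    rw [Polynomial.coeff_C_mul_X_pow]
    have htm : t < m := Finset.mem_range.mp ht
    by_cases hh : kr t + ∑ a ∈ u i, lam t a + (kc t + ∑ c ∈ w j, mu t c) = Φ i + Ψ j
    · rw [if_pos hh, if_pos ((hD_eq t htm i j).mpr hh).symm]
    · rw [if_neg hh, if_neg (fun h' => hh ((hD_eq t htm i j).mp h'.symm))]
  -- the leading form is the tight matrix
  set B : Matrix ι ι ℂ := Matrix.of fun i j => (A i j).coeff (Φn i + Ψn j) with hB
  have hBN : B = Matrix.of fun i j : ι => ∑ t ∈ Finset.range m,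
      (if kr t + ∑ a ∈ u i, lam t a + (kc t + ∑ c ∈ w j, mu t c) = Φ i + Ψ j then
        MvPolynomial.coeff (∑ a ∈ u i, Finsupp.single (Fin.castAdd h a) 1 +
          ∑ c ∈ w j, Finsupp.single (Fin.natAdd h c) 1) (F t) else 0) := by
    ext i j
    rw [hB, Matrix.of_apply, hAcoeff, Matrix.of_apply]
    simp only [hp, Matrix.of_apply]
  have hBdet : B.det ≠ 0 := by rw [hBN]; exact hN
  have hdetA : A.det ≠ 0 := by
    intro h0
    apply hBdet
    have := coeff_det_eq_det_coeff A Φn Ψn hAdeg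
    rw [h0, Polynomial.coeff_zero] at this
    exact this.symm
  -- evaluation point off the roots of `X · det A`
  have hXD : (Polynomial.X * A.det) ≠ 0 := mul_ne_zero Polynomial.X_ne_zero hdetA
  obtain ⟨x₀, hx₀⟩ := Infinite.exists_notMem_finset (Polynomial.X * A.det).roots.toFinset
  rw [Multiset.mem_toFinset, Polynomial.mem_roots hXD, Polynomial.IsRoot.def, Polynomial.eval_mul,
    Polynomial.eval_X, mul_eq_zero, not_or] at hx₀
  obtain ⟨hx₀ne, hdetx⟩ := hx₀
  have hevaldet : Polynomial.eval x₀ A.det =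
      (Matrix.of fun i j : ι => ∑ t ∈ Finset.range m, p t i j * x₀ ^ D t i j).det := by
    rw [← Polynomial.coe_evalRingHom, RingHom.map_det]
    congr 1
    ext i j
    simp [hA, RingHom.mapMatrix_apply, Matrix.map_apply, Polynomial.eval_finsetSum]
  -- the witness
  set s : ℕ → Fin (h + h) → ℂ := fun t i => Fin.addCases (fun a => x₀ ^ lam t a)
    (fun c => x₀ ^ mu t c) i with hs
  have hs_cast : ∀ t (a : Fin h), s t (Fin.castAdd h a) = x₀ ^ lam t a := fun t a =>
    Fin.addCases_left _
  have hs_nat : ∀ t (c : Fin h), s t (Fin.natAdd h c) = x₀ ^ mu t c := fun t c =>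
    Fin.addCases_right _
  set g : ℕ → MvPolynomial (Fin (h + h)) ℂ := fun t => ∑ dd ∈ (F t).support, MvPolynomial.monomial dd
      (MvPolynomial.coeff dd (F t) * ∏ i ∈ dd.support, s t i ^ dd i) with hg
  set f : MvPolynomial (Fin (h + h)) ℂ :=
    ∑ t ∈ Finset.range m, MvPolynomial.C (x₀ ^ (G₁ + G₂ + kr t + kc t)) * g t with hf
  refine ⟨f, ?_, ?_, ?_⟩
  · -- degree
    refine (MvPolynomial.totalDegree_finsetSum _ _).trans (Finset.sup_mono_fun fun t _ => ?_)
    refine (MvPolynomial.totalDegree_mul _ _).trans ?_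
    rw [MvPolynomial.totalDegree_C, zero_add]
    exact totalDegree_rescale_le (s t) (F t)
  · -- size
    calc complexity f
        ≤ ∑ t ∈ Finset.range m, complexity (MvPolynomial.C (x₀ ^ (G₁ + G₂ + kr t + kc t)) * g t) +
            (Finset.range m).card := complexity_finset_sum_le _ _
      _ ≤ ∑ t ∈ Finset.range m, (complexity (F t) + (h + h) + 1) + (Finset.range m).card := by
          gcongr with t ht
          calc _ ≤ complexity (MvPolynomial.C (x₀ ^ (G₁ + G₂ + kr t + kc t)) :
                  MvPolynomial (Fin (h + h)) ℂ) + complexity (g t) + 1 := complexity_mul_le_holds _ _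
            _ ≤ 0 + (complexity (F t) + (h + h)) + 1 := by
                gcongr
                · exact (complexity_C_holds _).le
                · exact complexity_rescale_le (s t) (F t)
            _ = _ := by ring
      _ = ∑ t ∈ Finset.range m, complexity (F t) + m * (h + h + 2) := by
          rw [Finset.sum_add_distrib, Finset.sum_add_distrib, Finset.sum_const, Finset.sum_const,
            Finset.card_range, smul_eq_mul, smul_eq_mul]
          ring
  · -- the layout matrix of `f` is the evaluated polynomial matrix
    have hcoef : ∀ i j : ι, MvPolynomial.coeff
        (∑ a ∈ u i, Finsupp.single (Fin.castAdd h a) 1 + ∑ c ∈ w j, Finsupp.single (Fin.natAdd h c) 1)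
        f = ∑ t ∈ Finset.range m, p t i j * x₀ ^ D t i j := by
      intro i j
      rw [hf, MvPolynomial.coeff_sum]
      refine Finset.sum_congr rfl fun t ht => ?_
      have htm : t < m := Finset.mem_range.mp ht
      rw [MvPolynomial.coeff_C_mul, hg, coeff_rescale, rescale_factor_partition]
      simp_rw [hs_cast, hs_nat]
      rw [prod_ite_zpow x₀ hx₀ne, prod_ite_zpow x₀ hx₀ne]
      have hpij : p t i j = MvPolynomial.coeff
          (∑ a ∈ u i, Finsupp.single (Fin.castAdd h a) 1 + ∑ c ∈ w j, Finsupp.single (Fin.natAdd h c) 1)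
          (F t) := rfl
      rw [hpij]
      have hpow : x₀ ^ (G₁ + G₂ + kr t + kc t) *
          (x₀ ^ (∑ a ∈ u i, lam t a) * x₀ ^ (∑ c ∈ w j, mu t c)) = x₀ ^ (D t i j) := by
        rw [← zpow_natCast, hD_cast t htm, ← zpow_add₀ hx₀ne, ← zpow_add₀ hx₀ne]
        congr 1
        simp only [hR, hCx]
        ring
      rw [← hpow]
      ring
    have hM : (Matrix.of fun i j : ι => MvPolynomial.coeff
        (∑ a ∈ u i, Finsupp.single (Fin.castAdd h a) 1 + ∑ c ∈ w j, Finsupp.single (Fin.natAdd h c) 1)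
        f) = Matrix.of fun i j : ι => ∑ t ∈ Finset.range m, p t i j * x₀ ^ D t i j := by
      ext i j
      rw [Matrix.of_apply, Matrix.of_apply, hcoef]
    rw [hM, ← hevaldet]
    exact hdetx

end Summit.ValiantsHypothesis.ValiantsHypothesis.Theorems.BarrierLever.StrataDoor
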